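import Summits.RiemannHypothesis.RiemannHypothesis.Theorems.MotivicDoorCastelnuovoSeveri

/-!
# Arithmetic Weil surfaces — the strengthened, prime-side-only axiom system (AWS sprint: structure)

HONEST LABEL (verbatim on every AWS file).  This is the hypothesis side of a ONE-WAY implication
`Nonempty ArithmeticWeilSurface → RiemannHypothesis` from a strengthened, PRIME-SIDE-ONLY axiom
system.  The existence of such an object is NOT claimed and is the located gap of the
Connes–Consani programme (cell `pub-rhdoor`, `LOCATED-GAP.md`); the converse direction is out of the
sprint's scope.  Framing: lottery ticket at the motivic door; RH probability negligible; consolation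
prizes are real: a new semi-local Weil-positivity theorem, or a located gap in the Connes–Consani
programme, plus the ff-door theorem.  No zeros of `ζ`, no RH-derived input anywhere in this file.

## The object (after Weil 1948, `C × C` over `𝔽_q`; Connes–Consani, arXiv:1805.10501 §3)

In Weil's proof the Néron–Severi lattice of `S = C × C` contains the two rulings `e₁ = C × pt`,
`e₂ = pt × C` (`e₁² = e₂² = 0`, `e₁·e₂ = 1`) and the graphs `Γ_n` of the powers of Frobenius, whose
mutual intersection numbers are POINT COUNTS `N_k = #C(𝔽_{q^k})` — prime-side data (closed points =
places) — and RH for `C` is the Castelnuovo–Severi inequality `D² ≤ 2 (D·e₁)(D·e₂)`, i.e. the Hodge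
index theorem on `⟨e₁, e₂⟩^⊥`.  In the Connes–Consani dictionary for `Spec ℤ` the graphs of Frobenius
become the scaling correspondences `Ψ_λ`, divisors are `D(f) = ∫ f(λ) Ψ_λ d*λ` for test functions `f`
on `ℝ₊*`, the two degrees are the masses `∫ f d*u`, `∫ f du` (`massDstar`, `massDu`), and the
intersection numbers are DECREED by the prime side of the explicit formula: `½ D(f)·D(f') = 𝔰(f, f') =
N(f ⋆ f̃')` (Essay normalisation, arXiv:1509.05576 p. 20) with Connes's counting distribution
`N(h) = Σ_n Λ(n) h(n) + ∫₁^∞ (u² h(u) − h(1))/(u² − 1) d*u + ½(log π + γ) h(1)`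
(`Literature.NumberTheory.ConnesConsani2019.ccN`, `ccPairing`; CC 2019 (15)–(17)) — the von Mangoldt
coefficients at the prime powers plus the archimedean density, nothing else.

An `ArithmeticWeilSurface` is then: an INTEGRAL lattice `L` (a `ℤ`-module of "divisor classes") with a
symmetric real-valued pairing (Arakelov-type: archimedean contributions are real), a hyperbolic pair
`e₁, e₂`, Frobenius-graph-type classes `frob i = "D(φ_i)"` attached to a GENERATING FAMILY `φ` of
real test functions (additive variable `t = log u`; `f_i = toMul φ_i`), whose pairings with `e₁`,
`e₂` and with each other EQUAL the prime-side data (`massDstar`, `massDu`, `ccPairing`) on every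
integer combination, the HODGE INDEX sign condition (the real-ified form is negative semidefinite on
`⟨e₁, e₂⟩^⊥`, stated on finite real combinations of lattice vectors, i.e. on `L ⊗ ℝ` without tensor
products), and the FORCING (density) axiom on the generating family: every real test function is a
`C¹`-limit, on a common window, of rational multiples of integer combinations of the `φ_i`
(`GeneratingFamily.dense`).  The forcing axiom is what lets "pairings agree with Weil's functional on the
generators" propagate to all test functions by routine continuity (statement file:
`CcDataContinuousOnWindow`), after which `forall_ccPairing_le_masses_iff_riemannHypothesis`
(`Theorems/MotivicDoorCastelnuovoSeveri`, PROVED) and `weil_criterion_holds` close the implication.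

Design notes (why these and not other fields) are in the cell's `pub-rhdoor-cc-3/AWS-DESIGN.md`;
in particular: (a) the pairing is real-valued, not `ℤ`-valued — for smoothed generators integrality
carries no information, and for the sharp graphs `Ψ_{p^k}` (where it would be canonical) the decreed
archimedean self-pairing is `-∞` (`Theorems/MotivicDoorDiagonalDivergence`, PROVED); (b) the index set
`ι` is a field, so finite truncation levels are the finite subfamilies `s : Finset ι` (carrier search).

References: A. Weil (1948); A. Mattuck, J. Tate, Abh. Math. Sem. Hamburg 22 (1958); A. Grothendieck,
J. reine angew. Math. 200 (1958); A. Connes, C. Consani, arXiv:1805.10501 §3; G. Faltings, Ann. of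
Math. 119 (1984) (Hodge index on arithmetic surfaces); E. Bombieri, Rend. Mat. Acc. Lincei (9) 11 (2000).
-/

noncomputable section

open Complex Set MeasureTheory Literature.NumberTheory.LFunctions
open Literature.NumberTheory.ConnesConsani2019
open Summit.RiemannHypothesis.RiemannHypothesis.Theorems.MotivicDoor.ConnesConsani
open scoped BigOperators

namespace Summit.RiemannHypothesis.RiemannHypothesis.Theorems.MotivicDoor.AWS

/-! ## Test-function combinations and the forcing (density) property -/

/-- The integer combination `u_c = Σ_i c_i φ_i` of a family of real test functions. -/
def testCombination {ι : Type*} (φ : ι → ℝ → ℝ) (c : ι →₀ ℤ) : ℝ → ℝ :=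
  fun t ↦ c.sum fun i n ↦ (n : ℝ) * φ i t

/-- **Generating (forcing) family.**  An index type `ι`, a family `φ : ι → ℝ → ℝ` of real Weil test
functions, and the DENSITY property: every real test function `u` is, on a window `[-R, R]`
containing its support, a `C¹`-limit (functions and derivatives, uniformly) of rational multiples
`N⁻¹ u_c` of integer combinations `u_c = Σ c_i φ_i` supported in the same window.  (For the chain:
`C¹`-convergence on a fixed window controls `‖·‖₂` and `‖·'‖₂`, hence Weil's functional through the
Markov decomposition `Re Q = P + 𝓔_a − M_a‖·‖₂²`, `D_t ≤ min(4‖g‖₂², t²‖g'‖₂²)`; it is a `Type`-valued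
structure so that a concrete family is supplied as a definition `def F : GeneratingFamily := …`.) -/
structure GeneratingFamily where
  /-- index set of the generators (finite truncation levels are `Finset ι`) -/
  ι : Type
  /-- the generators: real test functions of the additive variable `t = log u` -/
  φ : ι → ℝ → ℝ
  /-- every generator is a (real) Weil test function -/
  isWeilTest : ∀ i, IsWeilTest fun t ↦ (φ i t : ℂ)
  /-- density in the real test class, `C¹`-uniformly on a common window -/
  dense : ∀ u : ℝ → ℝ, IsWeilTest (fun t ↦ (u t : ℂ)) →
    ∃ R : ℝ, 0 < R ∧ tsupport u ⊆ Icc (-R) R ∧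
      ∀ ε : ℝ, 0 < ε → ∃ (N : ℕ) (c : ι →₀ ℤ), 0 < N ∧
        tsupport (testCombination φ c) ⊆ Icc (-R) R ∧
        (∀ t, |u t - (N : ℝ)⁻¹ * testCombination φ c t| ≤ ε) ∧
        (∀ t, |deriv u t - deriv (fun s ↦ (N : ℝ)⁻¹ * testCombination φ c s) t| ≤ ε)

/-! ## The structure -/

/-- **Arithmetic Weil surface** (strengthened, prime-side-only axiom system; see the module
docstring for the dictionary and the honest label).  Fields: a generating family of real test
functions with the forcing (density) property (`gen`); an integral lattice `L` with a symmetric real pairing; a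
hyperbolic pair `e₁, e₂`; Frobenius-graph-type classes `frob i` whose pairings on every integer
combination are the PRIME-SIDE data `∫ f d*u`, `∫ f du`, `𝔰(f, f) = N(f ⋆ f̃)` of
`Literature.NumberTheory.ConnesConsani2019`; and the Hodge-index sign condition on `⟨e₁, e₂⟩^⊥`
(real-ified, on finite real combinations of lattice vectors). -/
structure ArithmeticWeilSurface where
  /-- The generating family of real test functions with its density property (FORCING axiom). -/
  gen : GeneratingFamily
  /-- The integral lattice of divisor classes. -/
  L : Type
  [instAddCommGroup : AddCommGroup L]
  /-- The intersection pairing (biadditive, real-valued). -/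
  inter : L →+ L →+ ℝ
  inter_comm : ∀ x y : L, inter x y = inter y x
  /-- The two rulings. -/
  e₁ : L
  e₂ : L
  inter_e₁_e₁ : inter e₁ e₁ = 0
  inter_e₂_e₂ : inter e₂ e₂ = 0
  inter_e₁_e₂ : inter e₁ e₂ = 1
  /-- Frobenius-graph-type classes `frob i = D(φ_i) = ∫ φ_i dΨ`. -/
  frob : gen.ι → L
  /-- Degree data (prime side, trivial part): `D(u_c)·e₁ = ∫ f_c d*u`, `f_c = toMul u_c`. -/
  frob_e₁ : ∀ c : gen.ι →₀ ℤ,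
    inter (c.sum fun i n ↦ n • frob i) e₁ = massDstar (toMul (testCombination gen.φ c))
  /-- `D(u_c)·e₂ = ∫ f_c du`. -/
  frob_e₂ : ∀ c : gen.ι →₀ ℤ,
    inter (c.sum fun i n ↦ n • frob i) e₂ = massDu (toMul (testCombination gen.φ c))
  /-- INTERSECTION DATA FROM THE PRIME SIDE ONLY: `D(u_c)·D(u_c) = 2 𝔰(f_c, f_c) = 2 N(f_c ⋆ f̃_c)`,
  `N = Σ Λ(n) δ_n +` archimedean density (`ccN`; Essay normalisation `½ D.D = s(f,f)`,
  arXiv:1509.05576 p. 20). -/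
  frob_frob : ∀ c : gen.ι →₀ ℤ,
    inter (c.sum fun i n ↦ n • frob i) (c.sum fun i n ↦ n • frob i) =
      2 * ccPairing (toMul (testCombination gen.φ c)) (toMul (testCombination gen.φ c))
  /-- HODGE INDEX: the real-ified pairing is negative semidefinite on `⟨e₁, e₂⟩^⊥ ⊂ L ⊗ ℝ`
  (every element of `L ⊗ ℝ` is a finite real combination `Σ a_k v_k` of lattice vectors). -/
  hodge : ∀ (n : ℕ) (v : Fin n → L) (a : Fin n → ℝ),
    (∑ k, a k * inter (v k) e₁ = 0) → (∑ k, a k * inter (v k) e₂ = 0) →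
      ∑ k, ∑ l, a k * a l * inter (v k) (v l) ≤ 0

/-- The lattice of an arithmetic Weil surface is an additive commutative group. -/
instance (X : ArithmeticWeilSurface) : AddCommGroup X.L := X.instAddCommGroup

namespace ArithmeticWeilSurface

variable (X : ArithmeticWeilSurface)

/-- The cycle class `D(u_c) = Σ c_i frob i` of an integer combination. -/
def cycle (c : X.gen.ι →₀ ℤ) : X.L := c.sum fun i n ↦ n • X.frob i

/-- The test function `u_c = Σ c_i φ_i` of an integer combination. -/
def test (c : X.gen.ι →₀ ℤ) : ℝ → ℝ := testCombination X.gen.φ c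

/-- An integer combination of the generators is a (real) Weil test function. -/
theorem isWeilTest_test (c : X.gen.ι →₀ ℤ) : IsWeilTest fun t ↦ (X.test c t : ℂ) := by
  classical
  have key : ∀ s : Finset X.gen.ι,
      IsWeilTest fun t ↦ ∑ i ∈ s, ((c i : ℝ) : ℂ) * (X.gen.φ i t : ℂ) := by
    intro s
    induction s using Finset.induction_on with
    | empty =>
      simp only [Finset.sum_empty]
      change IsWeilTest (0 : ℝ → ℂ)
      exact ⟨contDiff_const, HasCompactSupport.zero⟩
    | insert i s hi ih =>
      simpa [Finset.sum_insert hi, Pi.add_def] using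
        ((X.gen.isWeilTest i).const_mul ((c i : ℝ) : ℂ)).add ih
  convert key c.support using 2 with t
  simp [test, testCombination, Finsupp.sum, Complex.ofReal_sum, Complex.ofReal_mul]

/-- `D(u_c)·e₁ = ∫ f_c d*u`. -/
@[simp] theorem inter_cycle_e₁ (c : X.gen.ι →₀ ℤ) :
    X.inter (X.cycle c) X.e₁ = massDstar (toMul (X.test c)) := X.frob_e₁ c

/-- `D(u_c)·e₂ = ∫ f_c du`. -/
@[simp] theorem inter_cycle_e₂ (c : X.gen.ι →₀ ℤ) :
    X.inter (X.cycle c) X.e₂ = massDu (toMul (X.test c)) := X.frob_e₂ c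

/-- `D(u_c)·D(u_c) = 2 𝔰(f_c, f_c)`. -/
@[simp] theorem inter_cycle_cycle (c : X.gen.ι →₀ ℤ) :
    X.inter (X.cycle c) (X.cycle c) = 2 * ccPairing (toMul (X.test c)) (toMul (X.test c)) :=
  X.frob_frob c

/-- `e₂·e₁ = 1`. -/
theorem inter_e₂_e₁ : X.inter X.e₂ X.e₁ = 1 := by rw [X.inter_comm, X.inter_e₁_e₂]

/-- A finite truncation LEVEL of the surface: the classes `e₁, e₂, frob i (i ∈ s)` for a finite
subfamily `s` (the carrier search works level by level; restriction between levels `s ⊆ s'` is the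
inclusion of subfamilies). -/
def levelClasses (s : Finset X.gen.ι) : Set X.L :=
  {X.e₁, X.e₂} ∪ (X.frob '' (s : Set X.gen.ι))

end ArithmeticWeilSurface

/-! ## Kernel-checked consequences of the axioms (orientation of the sign condition) -/

namespace ArithmeticWeilSurface

variable (X : ArithmeticWeilSurface)

/-- **Castelnuovo–Severi on the lattice** (the easy half, for one cycle): the Hodge-index field,
applied to the real combination `D − (D·e₂) e₁ − (D·e₁) e₂ ∈ ⟨e₁, e₂⟩^⊥` of the three lattice vectors
`D = cycle c, e₁, e₂`, gives `D·D ≤ 2 (D·e₁)(D·e₂)`. -/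
theorem inter_cycle_le (c : X.gen.ι →₀ ℤ) :
    X.inter (X.cycle c) (X.cycle c) ≤
      2 * (X.inter (X.cycle c) X.e₁ * X.inter (X.cycle c) X.e₂) := by
  set D := X.cycle c with hD
  set α := X.inter D X.e₁ with hα
  set β := X.inter D X.e₂ with hβ
  have h11 := X.inter_e₁_e₁
  have h22 := X.inter_e₂_e₂
  have h12 := X.inter_e₁_e₂
  have h21 := X.inter_e₂_e₁
  have h1D : X.inter X.e₁ D = α := by rw [X.inter_comm]
  have h2D : X.inter X.e₂ D = β := by rw [X.inter_comm]
  have H := X.hodge 3 ![D, X.e₁, X.e₂] ![1, -β, -α]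
    (by simp [Fin.sum_univ_three, h11, h21, ← hα])
    (by simp [Fin.sum_univ_three, h22, h12, ← hβ])
  simp only [Fin.sum_univ_three, Matrix.cons_val_zero, Matrix.cons_val_one, Matrix.head_cons,
    Matrix.cons_val_two, Matrix.tail_cons, h11, h22, h12, h21, h1D, h2D, ← hα, ← hβ] at H
  nlinarith [H]

/-- **`weilForm_eq_of_arithmeticWeilSurface` — the induced form IS minus Weil's functional on the
Frobenius span.**  For every integer combination `u_c` of the generators, the self-intersection of
the primitive part of its cycle (the component orthogonal to the rulings, `D² − 2(D·e₁)(D·e₂)`)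
equals `−Re W(u_c ⋆ ũ_c)`, Weil's quadratic functional — by the prime-side axioms and the PROVED
identity `2 𝔰(f,f) − 2 (∫ f d*u)(∫ f du) = −Re Q(u)` (`two_mul_ccPairing_sub_two_mul_masses_eq`,
itself from the explicit-formula bookkeeping of `Literature.NumberTheory.ConnesConsani2019`). -/
theorem weilForm_eq_of_arithmeticWeilSurface (c : X.gen.ι →₀ ℤ) :
    X.inter (X.cycle c) (X.cycle c) - 2 * (X.inter (X.cycle c) X.e₁ * X.inter (X.cycle c) X.e₂) =
      -(weilQuadratic fun t ↦ (X.test c t : ℂ)).re := by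
  rw [inter_cycle_cycle, inter_cycle_e₁, inter_cycle_e₂]
  exact two_mul_ccPairing_sub_two_mul_masses_eq (X.isWeilTest_test c)

/-- **Weil positivity on the Frobenius span**: `0 ≤ Re W(u_c ⋆ ũ_c)` for every integer combination
of the generators (Hodge index + the prime-side axioms). -/
theorem weilQuadratic_test_nonneg (c : X.gen.ι →₀ ℤ) :
    0 ≤ (weilQuadratic fun t ↦ (X.test c t : ℂ)).re := by
  have h₁ := X.inter_cycle_le c
  have h₂ := X.weilForm_eq_of_arithmeticWeilSurface c
  linarith

end ArithmeticWeilSurface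

/-! ## Statements (AWS sprint (b)): the named intermediate targets

Tagged `@[conjecture]` = open obligation nodes of the tree (no `sorry`; each is closed when a theorem
of that type lands).  Owners per the coordinator's plan: `CcDataContinuousOn` — aws-3
(TEST-CLASS-DOWN); `WeilPositivityForcing` — aws-2 (GENERATORS-UP: `weilQuadratic_test_nonneg` +
homogeneity `u_c ↦ N⁻¹ u_c` + `gen.dense` + `CcDataContinuousOn`) with lad-1 (`Chain`);
`RiemannHypothesisOfArithmeticWeilSurface` — closed by `riemannHypothesisOfAWS_of_forcing` below once
`WeilPositivityForcing` is. -/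

/-- **Meeting statement, TEST-CLASS-DOWN** (continuity of the prime-side data on a window): for real
test functions supported in `[-R, R]`, the three numbers `𝔰(f,f)`, `∫ f d*u`, `∫ f du` (`f = toMul u`)
depend continuously on `u` for `C¹`-uniform convergence on the window.  Route: `2𝔰(f,f) = P(u) −
Re Q(u)` (`two_mul_ccPairing_toMul_eq`), `Re Q = P + 𝓔_a − M_a ‖u‖₂²` (`WeilMarkovQuadratic`) with
`D_t(u) ≤ min(4‖u‖₂², t²‖u'‖₂²)`, polarisation of the sesquilinear form, and `|û(s)| ≤ e^{R/2} ‖u‖₁` on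
`0 ≤ Re s ≤ 1` for the masses / pole form. -/
@[conjecture] def CcDataContinuousOn (R : ℝ) : Prop :=
  ∀ u : ℝ → ℝ, IsWeilTest (fun t ↦ (u t : ℂ)) → tsupport u ⊆ Icc (-R) R →
    ∀ δ : ℝ, 0 < δ → ∃ ε : ℝ, 0 < ε ∧
      ∀ v : ℝ → ℝ, IsWeilTest (fun t ↦ (v t : ℂ)) → tsupport v ⊆ Icc (-R) R →
        (∀ t, |u t - v t| ≤ ε) → (∀ t, |deriv u t - deriv v t| ≤ ε) →
          |ccPairing (toMul u) (toMul u) - ccPairing (toMul v) (toMul v)| ≤ δ ∧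
          |massDstar (toMul u) - massDstar (toMul v)| ≤ δ ∧
          |massDu (toMul u) - massDu (toMul v)| ≤ δ

/-- **THE FORCING LEMMA (target)**: on an arithmetic Weil surface the Castelnuovo–Severi inequality
decreed on the Frobenius lattice is FORCED on the whole real test class —
`2 𝔰(f,f) ≤ 2 (∫ f d*u)(∫ f du)` for every real Weil test function (equivalently `0 ≤ Re Q(u)`,
`ccPairing_le_masses_iff`).  Proof plan: `weilQuadratic_test_nonneg` (span, PROVED) → rational
multiples by homogeneity → all `u` by `gen.dense` + `CcDataContinuousOn`. -/
@[conjecture] def WeilPositivityForcing : Prop :=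
  ∀ X : ArithmeticWeilSurface, ∀ u : ℝ → ℝ, IsWeilTest (fun t ↦ (u t : ℂ)) →
    2 * ccPairing (toMul u) (toMul u) ≤ 2 * (massDstar (toMul u) * massDu (toMul u))

/-- **THE SPRINT THEOREM (target statement)** `riemannHypothesis_of_arithmeticWeilSurface`:
one-way implication from the strengthened, prime-side-only axiom system.  The existence of an
`ArithmeticWeilSurface` is NOT claimed (located gap); the converse is out of scope. -/
@[conjecture] def RiemannHypothesisOfArithmeticWeilSurface : Prop :=
  Nonempty ArithmeticWeilSurface → _root_.RiemannHypothesis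

/-- **Glue (PROVED): the forcing lemma closes the sprint theorem**, through
`forall_ccPairing_le_masses_iff_riemannHypothesis` (`MotivicDoorCastelnuovoSeveri`: Castelnuovo–Severi
for every real `D(f)` ⟺ `WeilPositivity` ⟺ RH, the last step `weil_criterion_holds`). -/
theorem riemannHypothesisOfAWS_of_forcing (hF : WeilPositivityForcing) :
    RiemannHypothesisOfArithmeticWeilSurface := by
  rintro ⟨X⟩
  exact forall_ccPairing_le_masses_iff_riemannHypothesis.mp (hF X)

/-- The same glue with the surface explicit: `WeilPositivityForcing → ArithmeticWeilSurface → RH`. -/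
theorem riemannHypothesis_of_arithmeticWeilSurface_of_forcing (hF : WeilPositivityForcing)
    (X : ArithmeticWeilSurface) : _root_.RiemannHypothesis :=
  riemannHypothesisOfAWS_of_forcing hF ⟨X⟩

end Summit.RiemannHypothesis.RiemannHypothesis.Theorems.MotivicDoor.AWS
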